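/-
Origin: written from primary sources — R. Howe, *θ-series and invariant theory* (1979) §2–§3; S. Kudla, *Seesaw dual
reductive pairs* (1984) §1 (a see-saw pair need not be in block position: the second torus of PerL's plane is a
CONJUGATE `g (U(W₃) × U(W₄)) g⁻¹` of a block-diagonal one); A. Weil, Acta Math. 111 (1964) Chap. III n° 41 Thm 6
p. 193 (the operators `r_F(σ)` of rational symplectic elements fix `Θ`). Adapted: no. This file is the variant of
`AdelicSchwartzBruhatTensorCharacter` in which the external tensor `Φ₁ ⊠ Φ₂` is followed by a FIXED linear map `R`
(model case: the metaplectic operator of the rational element moving the conjugated torus into block position,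
composed with a relabelling of coordinates): the see-saw scalars along `t := R ∘ ⊠` again form a character, equal to
`1` wherever the three operators fix `Θ` — provided `Θ ∘ R = Θ`. Kernel only; the two-factor statement is a hypothesis.
-/
import Literature.NumberTheory.Automorphic.AdelicSchwartzBruhatTensorCharacter
import HarnessLib

/-!
# The see-saw character along a transported tensor `t = R ∘ ⊠`

For a number field `K`, `ι₁, ι₂`, a `ℂ`-module `V` (model case `V = 𝒮(𝔸_K^ι)` in OTHER coordinates), an injective
linear map `R : 𝒮(𝔸^{ι₁ ⊕ ι₂}) →ₗ[ℂ] V` and representations `M : G →* End V`, `A_j : G →* End 𝒮(𝔸^{ι_j})` of a group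
`G` with the per-element statement

  `h : ∀ g, ∃ c ≠ 0, ∀ Φ₁ Φ₂, M g (R (Φ₁ ⊠ Φ₂)) = c • R (A₁ g Φ₁ ⊠ A₂ g Φ₂)`

(the two-factor Schur statement for a see-saw torus CONJUGATED into block position by a rational element whose
metaplectic operator is (part of) `R`):

* `transportedTensor R := (tensorToSum K ι₁ ι₂).compr₂ R` — the bilinear map `t = R ∘ ⊠`; it is not identically zero
  when `R` is injective (`exists_transportedTensor_ne_zero`);
* **`seesawCharT R hR M A₁ A₂ h : G →* ℂˣ`** (`SeesawScalar.scalarChar` at `t`), `seesawCharT_spec`, `coe_seesawCharT_eq`;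
* **`seesawCharT_eq_one_of_theta`** — if a linear functional `ΘV` on `V` satisfies `ΘV ∘ R = Θ` (the theta
  distribution of `𝒮(𝔸^{ι₁ ⊕ ι₂})`) and `M g` fixes `ΘV`, `A_j g` fix `Θ`, then `χ(g) = 1` ([Weil1964] Thm 6 shape:
  model case `ΘV = Θ` in the other coordinates, `Θ ∘ R = Θ` because `R` is a rational metaplectic operator /
  relabelling);
* `twist_inv_seesawCharT_apply` — scheme (M) on the nose: `(χ⁻¹ • M) g (R (Φ₁ ⊠ Φ₂)) = R (A₁ g Φ₁ ⊠ A₂ g Φ₂)`.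

Continuity of `χ` is deliberately NOT treated here: conjugation by a fixed non-pointwise operator does not preserve
the coefficient topology, so the continuity of the transported character must come from a stronger continuity of the
representations (e.g. strong continuity of the archimedean factor on the compact torus), supplied by the consumer.
-/

open NumberField IsDedekindDomain
open Literature.RepresentationTheory Literature.RepresentationTheory.SeesawScalar
open scoped Classical

namespace Literature.NumberTheory.Automorphic

section Transported

open Literature.NumberTheory.Weil1964

variable {K : Type} [Field K] [NumberField K] {ι₁ ι₂ : Type} [Fintype ι₁] [Fintype ι₂]
variable {V : Type*} [AddCommGroup V] [Module ℂ V]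

/-- The transported tensor `t := R ∘ ⊠ : 𝒮(𝔸^{ι₁}) → 𝒮(𝔸^{ι₂}) → V`, bilinear. [folklore] -/
noncomputable def transportedTensor (R : piSchwartzBruhat K (ι₁ ⊕ ι₂) →ₗ[ℂ] V) :
    piSchwartzBruhat K ι₁ →ₗ[ℂ] piSchwartzBruhat K ι₂ →ₗ[ℂ] V :=
  (tensorToSum K ι₁ ι₂).compr₂ R

/-- Values of the transported tensor. [folklore] -/
@[simp] theorem transportedTensor_apply (R : piSchwartzBruhat K (ι₁ ⊕ ι₂) →ₗ[ℂ] V) (Φ₁ : piSchwartzBruhat K ι₁)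
    (Φ₂ : piSchwartzBruhat K ι₂) : transportedTensor R Φ₁ Φ₂ = R (tensorToSum K ι₁ ι₂ Φ₁ Φ₂) := rfl

/-- For injective `R` the transported tensor is not identically zero (Weil's witness). [folklore] -/
theorem exists_transportedTensor_ne_zero (R : piSchwartzBruhat K (ι₁ ⊕ ι₂) →ₗ[ℂ] V)
    (hR : Function.Injective R) :
    ∃ (Φ₁ : piSchwartzBruhat K ι₁) (Φ₂ : piSchwartzBruhat K ι₂), transportedTensor R Φ₁ Φ₂ ≠ 0 := by
  obtain ⟨Φ₁, Φ₂, hne⟩ := exists_tensorToSum_ne_zero' (K := K) (ι₁ := ι₁) (ι₂ := ι₂)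
  refine ⟨Φ₁, Φ₂, fun h0 => hne (hR ?_)⟩
  rw [map_zero]
  exact h0

variable {G : Type*} [Group G] (R : piSchwartzBruhat K (ι₁ ⊕ ι₂) →ₗ[ℂ] V) (hR : Function.Injective R)
  (M : Representation ℂ G V) (A₁ : Representation ℂ G (piSchwartzBruhat K ι₁))
  (A₂ : Representation ℂ G (piSchwartzBruhat K ι₂))
  (h : ∀ g : G, ∃ c : ℂ, c ≠ 0 ∧ ∀ (Φ₁ : piSchwartzBruhat K ι₁) (Φ₂ : piSchwartzBruhat K ι₂),
    M g (R (tensorToSum K ι₁ ι₂ Φ₁ Φ₂)) = c • R (tensorToSum K ι₁ ι₂ (A₁ g Φ₁) (A₂ g Φ₂)))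

include h in
/-- The hypothesis in the shape `SeesawScalar.scalarChar` consumes (along `t = R ∘ ⊠`). [folklore] -/
theorem transported_hypothesis :
    ∀ g : G, ∃ c : ℂ, c ≠ 0 ∧ ∀ (Φ₁ : piSchwartzBruhat K ι₁) (Φ₂ : piSchwartzBruhat K ι₂),
      M g (transportedTensor R Φ₁ Φ₂) = c • transportedTensor R (A₁ g Φ₁) (A₂ g Φ₂) := by
  intro g
  obtain ⟨c, hc, hcg⟩ := h g
  exact ⟨c, hc, fun Φ₁ Φ₂ => by rw [transportedTensor_apply, transportedTensor_apply, hcg]⟩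

include hR h in
/-- **The see-saw character along a transported tensor** `t = R ∘ ⊠` (conjugated see-saw torus):
`G →* ℂˣ`. (cf. S. Kudla, Seesaw dual reductive pairs (1984) §1) [folklore] -/
noncomputable def seesawCharT : G →* ℂˣ :=
  scalarChar (transportedTensor R) M A₁ A₂ (transported_hypothesis R M A₁ A₂ h)
    (exists_transportedTensor_ne_zero R hR)

include hR h in
/-- The defining identity `M g (R (Φ₁ ⊠ Φ₂)) = χ(g) • R (A₁ g Φ₁ ⊠ A₂ g Φ₂)`. [folklore] -/
theorem seesawCharT_spec (g : G) (Φ₁ : piSchwartzBruhat K ι₁) (Φ₂ : piSchwartzBruhat K ι₂) :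
    M g (R (tensorToSum K ι₁ ι₂ Φ₁ Φ₂)) =
      (seesawCharT R hR M A₁ A₂ h g : ℂ) • R (tensorToSum K ι₁ ι₂ (A₁ g Φ₁) (A₂ g Φ₂)) :=
  scalarChar_spec (transportedTensor R) M A₁ A₂ (transported_hypothesis R M A₁ A₂ h)
    (exists_transportedTensor_ne_zero R hR) g Φ₁ Φ₂

include hR h in
/-- Uniqueness: any scalar that works at `g` is `χ(g)`. [folklore] -/
theorem coe_seesawCharT_eq {g : G} {c : ℂ}
    (hc : ∀ (Φ₁ : piSchwartzBruhat K ι₁) (Φ₂ : piSchwartzBruhat K ι₂),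
      M g (R (tensorToSum K ι₁ ι₂ Φ₁ Φ₂)) = c • R (tensorToSum K ι₁ ι₂ (A₁ g Φ₁) (A₂ g Φ₂))) :
    (seesawCharT R hR M A₁ A₂ h g : ℂ) = c :=
  coe_scalarChar_eq (transportedTensor R) M A₁ A₂ (transported_hypothesis R M A₁ A₂ h)
    (exists_transportedTensor_ne_zero R hR) (fun Φ₁ Φ₂ => by
      rw [transportedTensor_apply, transportedTensor_apply]; exact hc Φ₁ Φ₂)

include hR h in
/-- **`χ(g) = 1` under `Θ`-invariance, transported**: if `ΘV ∘ R = Θ`, `M g` fixes `ΘV` and `A₁ g`, `A₂ g` fix `Θ`,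
then the scalar at `g` is `1`. (Model case: `ΘV` the theta distribution in the other coordinates, `R` a rational
metaplectic operator composed with a relabelling, `g` a rational point.) [cite: Weil1964, Chap. III n° 41, Thm 6 p. 193] -/
theorem seesawCharT_eq_one_of_theta (ΘV : V →ₗ[ℂ] ℂ)
    (hΘR : ∀ Ψ : piSchwartzBruhat K (ι₁ ⊕ ι₂), ΘV (R Ψ) = thetaDistLM K (ι₁ ⊕ ι₂) Ψ) {g : G}
    (hM : ∀ v, ΘV (M g v) = ΘV v)
    (hA₁ : ∀ Φ, thetaDistLM K ι₁ (A₁ g Φ) = thetaDistLM K ι₁ Φ)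
    (hA₂ : ∀ Φ, thetaDistLM K ι₂ (A₂ g Φ) = thetaDistLM K ι₂ Φ) :
    seesawCharT R hR M A₁ A₂ h g = 1 := by
  apply Units.ext
  rw [Units.val_one]
  refine TensorScalar.scalar_eq_one_of_functional (transportedTensor R) (M g) (A₁ g) (A₂ g) _
    (fun Φ₁ Φ₂ => ?_) ΘV (thetaDistLM K ι₁) (thetaDistLM K ι₂) (fun Φ₁ Φ₂ => ?_) hM hA₁ hA₂
    (exists_thetaDistLM_ne_zero K ι₁) (exists_thetaDistLM_ne_zero K ι₂)
  · rw [transportedTensor_apply, transportedTensor_apply]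
    exact seesawCharT_spec R hR M A₁ A₂ h g Φ₁ Φ₂
  · rw [transportedTensor_apply, hΘR, thetaDistLM_tensorToSum]

include hR h in
/-- Hence at such an element the `χ⁻¹`-twisted `M` agrees with `M`. [folklore] -/
theorem twist_inv_seesawCharT_eq_of_theta (ΘV : V →ₗ[ℂ] ℂ)
    (hΘR : ∀ Ψ : piSchwartzBruhat K (ι₁ ⊕ ι₂), ΘV (R Ψ) = thetaDistLM K (ι₁ ⊕ ι₂) Ψ) {g : G}
    (hM : ∀ v, ΘV (M g v) = ΘV v)
    (hA₁ : ∀ Φ, thetaDistLM K ι₁ (A₁ g Φ) = thetaDistLM K ι₁ Φ)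
    (hA₂ : ∀ Φ, thetaDistLM K ι₂ (A₂ g Φ) = thetaDistLM K ι₂ Φ) :
    twist (seesawCharT R hR M A₁ A₂ h)⁻¹ M g = M g :=
  twist_apply_of_eq_one M (by
    rw [MonoidHom.inv_apply, seesawCharT_eq_one_of_theta R hR M A₁ A₂ h ΘV hΘR hM hA₁ hA₂, inv_one])

include hR h in
/-- **Scheme (M) on the nose, transported**: `(χ⁻¹ • M) g (R (Φ₁ ⊠ Φ₂)) = R (A₁ g Φ₁ ⊠ A₂ g Φ₂)`. [folklore] -/
theorem twist_inv_seesawCharT_apply (g : G) (Φ₁ : piSchwartzBruhat K ι₁) (Φ₂ : piSchwartzBruhat K ι₂) :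
    twist (seesawCharT R hR M A₁ A₂ h)⁻¹ M g (R (tensorToSum K ι₁ ι₂ Φ₁ Φ₂)) =
      R (tensorToSum K ι₁ ι₂ (A₁ g Φ₁) (A₂ g Φ₂)) :=
  twist_inv_scalarChar_apply_tensor (transportedTensor R) M A₁ A₂ (transported_hypothesis R M A₁ A₂ h)
    (exists_transportedTensor_ne_zero R hR) g Φ₁ Φ₂

include hR in
/-- **Scheme (small) on the nose, transported, for the see-saw product group** `G = GV × (U₁ × U₂)`, `A_j` on
`GV × U_j` (`seesawFst`/`seesawSnd`): keep `M`; twist `A₁` by `charSmall₁`, `A₂` by `charSmall₂` (of the transported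
tensor); then `M (g,(u₁,u₂)) (R (Φ₁ ⊠ Φ₂)) = R (A₁′ (g,u₁) Φ₁ ⊠ A₂′ (g,u₂) Φ₂)`. [folklore] -/
theorem seesaw_transported_twist_small {GV U₁ U₂ : Type*} [Group GV] [Group U₁] [Group U₂]
    (M₃ : Representation ℂ (GV × (U₁ × U₂)) V) (B₁ : Representation ℂ (GV × U₁) (piSchwartzBruhat K ι₁))
    (B₂ : Representation ℂ (GV × U₂) (piSchwartzBruhat K ι₂))
    (h₃ : ∀ p : GV × (U₁ × U₂), ∃ c : ℂ, c ≠ 0 ∧ ∀ (Φ₁ : piSchwartzBruhat K ι₁) (Φ₂ : piSchwartzBruhat K ι₂),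
      M₃ p (transportedTensor R Φ₁ Φ₂) =
        c • transportedTensor R (B₁ (seesawFst GV U₁ U₂ p) Φ₁) (B₂ (seesawSnd GV U₁ U₂ p) Φ₂))
    (g : GV) (u₁ : U₁) (u₂ : U₂) (Φ₁ : piSchwartzBruhat K ι₁) (Φ₂ : piSchwartzBruhat K ι₂) :
    M₃ (g, (u₁, u₂)) (R (tensorToSum K ι₁ ι₂ Φ₁ Φ₂)) =
      R (tensorToSum K ι₁ ι₂
        (twist (charSmall₁ (transportedTensor R) M₃ B₁ B₂ h₃ (exists_transportedTensor_ne_zero R hR)) B₁ (g, u₁) Φ₁)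
        (twist (charSmall₂ (transportedTensor R) M₃ B₁ B₂ h₃ (exists_transportedTensor_ne_zero R hR)) B₂ (g, u₂) Φ₂)) :=
  seesaw_restrict_twist_small (transportedTensor R) M₃ B₁ B₂ h₃ (exists_transportedTensor_ne_zero R hR) g u₁ u₂ Φ₁ Φ₂

end Transported

end Literature.NumberTheory.Automorphic
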